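import Summits.AnomalousDissipation.AnomalousDissipation.Theorems.SolenoidalFractalHomogenisationLagrangianStepVmodCorrectedGeneratorFrame
import HarnessLib

/-!
# K1L_D (stmt-AnomalousDissipation-27980), (ℓ3-A) road A, (S2-adj) glue: the gradient of the corrected test from BELOW —
# `gradNormSq (J•ζ) ≥ ½(1 − 18θ)²·gradNormSq ζ − 108θ²nC²·∫‖ζ‖²` (the `m` input of `EnergyDuhamelG.lossAdj_ge_onsetWindow`, sup-norm version)
(helper; `--supports 27980 --as helper`; prover ad-k1loc-p3 g12; the (S1)-type pointwise technology read as a LOWER bound.)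

CONVENTION (D28-8′): derivative-index distortion `Torus.Visc4.conj`; constraint `∇·(G v) = 0`.

`∂_c(J•ζ) = ∂_cζ + (J − 1)∂_cζ + (∂_cJ)ζ` pointwise (`partialDeriv_distort_apply`); a `3×3` matrix with entries `≤ ε` maps `w ↦ Ew` with
`‖Ew‖ ≤ 3ε‖w‖` (Cauchy–Schwarz per row), so `‖∂_c(J•ζ)(y)‖ ≥ (1 − 3ε)‖∂_cζ(y)‖ − 3C₁‖ζ(y)‖` for `|J − 1| ≤ ε`, `|∂J| ≤ C₁`, hence
`‖∂_c(J•ζ)(y)‖² ≥ ½(1 − 3ε)²‖∂_cζ(y)‖² − 9C₁²‖ζ(y)‖²` and, integrating and summing over `c`,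
`gradNormSq (J•ζ) ≥ ½(1−3ε)²·gradNormSq ζ − 27C₁²·∫‖ζ‖²`.  Along the frame class (`G J = 1`, `|G − 1| ≤ θ ≤ 1/18`, `|J| ≤ 2`): `|J − 1| ≤ 6θ`
(`J − 1 = (1 − G)J`), `C₁ = 2θnC`, giving `½(1 − 18θ)²·gradNormSq ζ − 108θ²nC²·∫‖ζ‖²` — for a slow band `≈ ½‖∇ζ‖²` once `|ℓ| ≳ θnC`
(FINDING F-p3g12-1: the sup-norm road does not see that `(∂J)ζ` is nearly orthogonal to `∂ζ` for band-limited `ζ`).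
* `abs_inv_sub_one_le`, `norm_mulVecE_le`, `norm_partialDeriv_distort_ge_pt`, `sq_ge_half_sq_sub_sq`, **`gradNormSq_distort_ge`**,
  **`IsFrameRegular.gradNormSq_correctedTest_ge`**.
`sorry`-free; NOT a proof of any block, of K1L_D or of AD; rung F-D1.A0.
-/

set_option linter.dupNamespace false

noncomputable section

namespace Summit.AnomalousDissipation.AnomalousDissipation.Theorems.SolenoidalFractalHomogenisation.LagrangianStep.VmodDist

open Literature.Analysis Literature.Analysis.FluidPDE Literature.Analysis.FunctionSpaces
open MeasureTheory Set Filter Function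
open scoped ENNReal NNReal InnerProductSpace
open Summit.AnomalousDissipation.AnomalousDissipation.Theorems.SolenoidalFractalHomogenisation.LagrangianStep.CellClauseMod

/-! ## §1 Matrix algebra -/

/-- **`|J − 1| ≤ 6θ` entrywise** for `G J = 1`, `|G − 1| ≤ θ`, `|J| ≤ 2` (`J − 1 = (1 − G)J`). -/
theorem abs_inv_sub_one_le {G J : Matrix (Fin 3) (Fin 3) ℝ} {θ : ℝ} (hGJ : G * J = 1)
    (hG : ∀ i j, |G i j - (1 : Matrix (Fin 3) (Fin 3) ℝ) i j| ≤ θ) (hJ : ∀ a c, |J a c| ≤ 2) (a m : Fin 3) :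
    |J a m - (1 : Matrix (Fin 3) (Fin 3) ℝ) a m| ≤ 6 * θ := by
  have h := congrArg (fun M : Matrix (Fin 3) (Fin 3) ℝ => M a m) hGJ
  simp only [Matrix.mul_apply] at h
  -- `J a m − δ a m = Σ_b (δ_ab − G_ab) J_bm`
  have e : J a m - (1 : Matrix (Fin 3) (Fin 3) ℝ) a m = ∑ b, ((1 : Matrix (Fin 3) (Fin 3) ℝ) a b - G a b) * J b m := by
    have e1 : ∑ b, ((1 : Matrix (Fin 3) (Fin 3) ℝ) a b - G a b) * J b m = ∑ b, (1 : Matrix (Fin 3) (Fin 3) ℝ) a b * J b m - ∑ b, G a b * J b m := by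
      rw [← Finset.sum_sub_distrib]; exact Finset.sum_congr rfl fun b _ => by ring
    rw [e1, h, ← Matrix.mul_apply, Matrix.one_mul]
  rw [e]
  refine (Finset.abs_sum_le_sum_abs _ _).trans ?_
  calc ∑ b, |((1 : Matrix (Fin 3) (Fin 3) ℝ) a b - G a b) * J b m| ≤ ∑ _b : Fin 3, θ * 2 := Finset.sum_le_sum fun b _ => by
          rw [abs_mul, abs_sub_comm]
          exact mul_le_mul (hG a b) (hJ b m) (abs_nonneg _) ((abs_nonneg _).trans (hG a b))
    _ = 6 * θ := by simp only [Finset.sum_const, Finset.card_univ, Fintype.card_fin, nsmul_eq_mul]; push_cast; ring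

/-- **A `3×3` matrix with entries `≤ ε` acts with norm `≤ 3ε` on `ℝ³`** (row-wise Cauchy–Schwarz):
`‖(a ↦ Σ_m E_{am} w_m)‖ ≤ 3ε‖w‖`. -/
theorem norm_mulVecE_le {E : Matrix (Fin 3) (Fin 3) ℝ} {ε : ℝ} (hε : 0 ≤ ε) (hE : ∀ a m, |E a m| ≤ ε) (w : EuclideanSpace ℝ (Fin 3)) :
    ‖(WithLp.toLp 2 fun a => ∑ m, E a m * w m : EuclideanSpace ℝ (Fin 3))‖ ≤ 3 * ε * ‖w‖ := by
  have hw2 : ∑ m, w m ^ 2 = ‖w‖ ^ 2 := by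
    rw [EuclideanSpace.norm_sq_eq]; exact Finset.sum_congr rfl fun m _ => by rw [Real.norm_eq_abs, sq_abs]
  have hrow : ∀ a, (∑ m, E a m * w m) ^ 2 ≤ 3 * ε ^ 2 * ‖w‖ ^ 2 := by
    intro a
    have hcs := Finset.sum_mul_sq_le_sq_mul_sq Finset.univ (fun m => E a m) (fun m => w m)
    have hE2 : ∑ m, E a m ^ 2 ≤ 3 * ε ^ 2 := by
      calc ∑ m, E a m ^ 2 ≤ ∑ _m : Fin 3, ε ^ 2 := Finset.sum_le_sum fun m _ => by
              have := hE a m; rw [← sq_abs]; exact pow_le_pow_left₀ (abs_nonneg _) this 2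
        _ = 3 * ε ^ 2 := by simp only [Finset.sum_const, Finset.card_univ, Fintype.card_fin, nsmul_eq_mul]; push_cast; ring
    rw [hw2] at hcs
    calc (∑ m, E a m * w m) ^ 2 ≤ (∑ m, E a m ^ 2) * ‖w‖ ^ 2 := hcs
      _ ≤ 3 * ε ^ 2 * ‖w‖ ^ 2 := mul_le_mul_of_nonneg_right hE2 (sq_nonneg _)
  have hsq : ‖(WithLp.toLp 2 fun a => ∑ m, E a m * w m : EuclideanSpace ℝ (Fin 3))‖ ^ 2 ≤ (3 * ε * ‖w‖) ^ 2 := by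
    rw [EuclideanSpace.norm_sq_eq]
    calc ∑ a, ‖(WithLp.toLp 2 fun a => ∑ m, E a m * w m : EuclideanSpace ℝ (Fin 3)) a‖ ^ 2 = ∑ a, (∑ m, E a m * w m) ^ 2 :=
          Finset.sum_congr rfl fun a _ => by rw [PiLp.toLp_apply, Real.norm_eq_abs, sq_abs]
      _ ≤ ∑ _a : Fin 3, 3 * ε ^ 2 * ‖w‖ ^ 2 := Finset.sum_le_sum fun a _ => hrow a
      _ = (3 * ε * ‖w‖) ^ 2 := by simp only [Finset.sum_const, Finset.card_univ, Fintype.card_fin, nsmul_eq_mul]; push_cast; ring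
  have h0 : 0 ≤ 3 * ε * ‖w‖ := by positivity
  nlinarith [hsq, norm_nonneg (WithLp.toLp 2 fun a => ∑ m, E a m * w m : EuclideanSpace ℝ (Fin 3)), h0]

/-! ## §2 The pointwise lower bound -/

variable {Jt : UnitAddTorus (Fin 3) → Matrix (Fin 3) (Fin 3) ℝ} {ζ : VF}

/-- **Decomposition** `∂_c(J•ζ)(y) = ∂_cζ(y) + (J − 1)∂_cζ(y) + (∂_cJ)ζ(y)`. -/
theorem partialDeriv_distort_eq_add (hJ : ∀ a m, Torus.IsSmooth (fun y => Jt y a m)) (hζ : Torus.IsSmooth ζ)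
    (c : Fin 3) (y : UnitAddTorus (Fin 3)) :
    Torus.partialDeriv c (Torus.distort Jt ζ) y
      = Torus.partialDeriv c ζ y
        + (WithLp.toLp 2 fun a => ∑ m, (Jt y a m - (1 : Matrix (Fin 3) (Fin 3) ℝ) a m) * (Torus.partialDeriv c ζ y) m : EuclideanSpace ℝ (Fin 3))
        + (WithLp.toLp 2 fun a => ∑ m, Torus.partialDeriv c (fun y => Jt y a m) y * ζ y m : EuclideanSpace ℝ (Fin 3)) := by
  ext a
  rw [partialDeriv_distort_apply hJ hζ c y a, PiLp.add_apply, PiLp.add_apply, PiLp.toLp_apply, PiLp.toLp_apply]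
  have e1 : (Torus.partialDeriv c ζ y) a = ∑ m, (1 : Matrix (Fin 3) (Fin 3) ℝ) a m * (Torus.partialDeriv c ζ y) m := by
    simp [Matrix.one_apply]
  rw [e1, ← Finset.sum_add_distrib, ← Finset.sum_add_distrib]
  exact Finset.sum_congr rfl fun m _ => by ring

/-- **Pointwise lower bound**: `(1 − 3ε)‖∂_cζ(y)‖ − 3C₁‖ζ(y)‖ ≤ ‖∂_c(J•ζ)(y)‖` for `|J − 1| ≤ ε`, `|∂J| ≤ C₁`. -/
theorem norm_partialDeriv_distort_ge_pt (hJ : ∀ a m, Torus.IsSmooth (fun y => Jt y a m)) (hζ : Torus.IsSmooth ζ) {ε C₁ : ℝ}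
    (hε0 : 0 ≤ ε) (hC1 : 0 ≤ C₁) (hJe : ∀ y a m, |Jt y a m - (1 : Matrix (Fin 3) (Fin 3) ℝ) a m| ≤ ε)
    (hJ1 : ∀ y a m c, |Torus.partialDeriv c (fun y => Jt y a m) y| ≤ C₁) (c : Fin 3) (y : UnitAddTorus (Fin 3)) :
    (1 - 3 * ε) * ‖Torus.partialDeriv c ζ y‖ - 3 * C₁ * ‖ζ y‖ ≤ ‖Torus.partialDeriv c (Torus.distort Jt ζ) y‖ := by
  rw [partialDeriv_distort_eq_add hJ hζ c y]
  set u := Torus.partialDeriv c ζ y with hu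
  set v : EuclideanSpace ℝ (Fin 3) := WithLp.toLp 2 fun a => ∑ m, (Jt y a m - (1 : Matrix (Fin 3) (Fin 3) ℝ) a m) * u m with hv
  set w : EuclideanSpace ℝ (Fin 3) := WithLp.toLp 2 fun a => ∑ m, Torus.partialDeriv c (fun y => Jt y a m) y * ζ y m with hw
  have hA : ‖v‖ ≤ 3 * ε * ‖u‖ := norm_mulVecE_le (E := fun a m => Jt y a m - (1 : Matrix (Fin 3) (Fin 3) ℝ) a m) hε0 (fun a m => hJe y a m) u
  have hB : ‖w‖ ≤ 3 * C₁ * ‖ζ y‖ :=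
    norm_mulVecE_le (E := fun a m => Torus.partialDeriv c (fun y => Jt y a m) y) hC1 (fun a m => hJ1 y a m c) (ζ y)
  have h1 : ‖u‖ ≤ ‖u + v + w‖ + ‖v‖ + ‖w‖ := by
    have e : u = (u + v + w) - (v + w) := by abel
    calc ‖u‖ = ‖(u + v + w) - (v + w)‖ := by rw [← e]
      _ ≤ ‖u + v + w‖ + ‖v + w‖ := norm_sub_le _ _
      _ ≤ ‖u + v + w‖ + (‖v‖ + ‖w‖) := by linarith [norm_add_le v w]
      _ = _ := by ring
  nlinarith [h1, hA, hB]

/-! ## §3 Squaring and integrating -/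

/-- `a²/2 − b² ≤ x²` from `a − b ≤ x`, `0 ≤ a`. -/
theorem sq_ge_half_sq_sub_sq {x a b : ℝ} (ha : 0 ≤ a) (h : a - b ≤ x) : a ^ 2 / 2 - b ^ 2 ≤ x ^ 2 := by
  rcases le_or_gt a b with hab | hab
  · have : a ^ 2 ≤ b ^ 2 := pow_le_pow_left₀ ha hab 2
    nlinarith [sq_nonneg x]
  · have h2 : (a - b) ^ 2 ≤ x ^ 2 := pow_le_pow_left₀ (by linarith) h 2
    nlinarith [sq_nonneg (a - 2 * b)]

/-- **`gradNormSq (J•ζ) ≥ ½(1 − 3ε)²·gradNormSq ζ − 27C₁²·∫‖ζ‖²`** for `|J − 1| ≤ ε ≤ 1/3`, `|∂J| ≤ C₁`. -/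
theorem gradNormSq_distort_ge (hJ : ∀ a m, Torus.IsSmooth (fun y => Jt y a m)) (hζ : Torus.IsSmooth ζ) {ε C₁ : ℝ}
    (hε0 : 0 ≤ ε) (hε1 : 3 * ε ≤ 1) (hC1 : 0 ≤ C₁) (hJe : ∀ y a m, |Jt y a m - (1 : Matrix (Fin 3) (Fin 3) ℝ) a m| ≤ ε)
    (hJ1 : ∀ y a m c, |Torus.partialDeriv c (fun y => Jt y a m) y| ≤ C₁) :
    (1 - 3 * ε) ^ 2 / 2 * Torus.gradNormSq ζ - 27 * C₁ ^ 2 * ∫ x, ‖ζ x‖ ^ 2 ≤ Torus.gradNormSq (Torus.distort Jt ζ) := by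
  have hΨ : Torus.IsSmooth (Torus.distort Jt ζ) := Torus.isSmooth_distort hJ hζ
  have hpt : ∀ y, (1 - 3 * ε) ^ 2 / 2 * (∑ c, ‖Torus.partialDeriv c ζ y‖ ^ 2) - 27 * C₁ ^ 2 * ‖ζ y‖ ^ 2
      ≤ ∑ c, ‖Torus.partialDeriv c (Torus.distort Jt ζ) y‖ ^ 2 := by
    intro y
    have hc : ∀ c, ((1 - 3 * ε) * ‖Torus.partialDeriv c ζ y‖) ^ 2 / 2 - (3 * C₁ * ‖ζ y‖) ^ 2
        ≤ ‖Torus.partialDeriv c (Torus.distort Jt ζ) y‖ ^ 2 := fun c =>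
      sq_ge_half_sq_sub_sq (mul_nonneg (by linarith) (norm_nonneg _)) (norm_partialDeriv_distort_ge_pt hJ hζ hε0 hC1 hJe hJ1 c y)
    calc (1 - 3 * ε) ^ 2 / 2 * (∑ c, ‖Torus.partialDeriv c ζ y‖ ^ 2) - 27 * C₁ ^ 2 * ‖ζ y‖ ^ 2
        = ∑ c, (((1 - 3 * ε) * ‖Torus.partialDeriv c ζ y‖) ^ 2 / 2 - (3 * C₁ * ‖ζ y‖) ^ 2) := by
          simp only [Finset.sum_sub_distrib, Finset.sum_const, Finset.card_univ, Fintype.card_fin, nsmul_eq_mul, Finset.mul_sum]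
          push_cast
          have : ∀ c, (1 - 3 * ε) ^ 2 / 2 * ‖Torus.partialDeriv c ζ y‖ ^ 2 = ((1 - 3 * ε) * ‖Torus.partialDeriv c ζ y‖) ^ 2 / 2 :=
            fun c => by ring
          simp only [this]
          ring
      _ ≤ ∑ c, ‖Torus.partialDeriv c (Torus.distort Jt ζ) y‖ ^ 2 := Finset.sum_le_sum fun c _ => hc c
  -- integrability (everything is continuous on the compact torus)
  have hi1 : Integrable (fun y => ∑ c, ‖Torus.partialDeriv c ζ y‖ ^ 2) volume :=
    (continuous_finsetSum _ fun c _ => ((hζ.partialDeriv c).continuous.norm.pow 2)).integrable_unitAddTorus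
  have hi2 : Integrable (fun y => ‖ζ y‖ ^ 2) volume := (hζ.continuous.norm.pow 2).integrable_unitAddTorus
  have hi3 : Integrable (fun y => ∑ c, ‖Torus.partialDeriv c (Torus.distort Jt ζ) y‖ ^ 2) volume :=
    (continuous_finsetSum _ fun c _ => ((hΨ.partialDeriv c).continuous.norm.pow 2)).integrable_unitAddTorus
  unfold Torus.gradNormSq
  rw [← integral_const_mul, ← integral_const_mul, ← integral_sub (hi1.const_mul _) (hi2.const_mul _)]
  exact integral_mono ((hi1.const_mul _).sub (hi2.const_mul _)) hi3 hpt

/-! ## §4 Along the frame class -/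

variable {θ Tw nC : ℝ} {G J : ℝ → UnitAddTorus (Fin 3) → Matrix (Fin 3) (Fin 3) ℝ}

/-- **The `m`-input of the onset window along the frame class** (`θ ≤ 1/18`): at every window time `t ∈ [0,Tw]` and for every smooth `ζ`,
`½(1 − 18θ)²·gradNormSq ζ − 108θ²nC²·∫‖ζ‖² ≤ gradNormSq (J t•ζ)`. -/
theorem IsFrameRegular.gradNormSq_correctedTest_ge (hR : IsFrameRegular θ Tw nC G J) (hG : IsFrameModulation θ Tw nC G) (hθ : θ ≤ 1 / 18)
    (hnC : 0 ≤ nC) {t : ℝ} (ht : t ∈ Icc 0 Tw) (hζ : Torus.IsSmooth ζ) :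
    (1 - 18 * θ) ^ 2 / 2 * Torus.gradNormSq ζ - 108 * θ ^ 2 * nC ^ 2 * ∫ x, ‖ζ x‖ ^ 2 ≤ Torus.gradNormSq (Torus.distort (J t) ζ) := by
  have hTw : 0 ≤ Tw := ht.1.trans ht.2
  have hθ0 : 0 ≤ θ := theta_nonneg_of_isFrameModulation hG hTw
  have key := gradNormSq_distort_ge (Jt := J t) (hR.smooth t) hζ (ε := 6 * θ) (C₁ := 2 * θ * nC) (by positivity) (by linarith) (by positivity)
    (fun y a m => abs_inv_sub_one_le (hR.mul_eq_one t y) (fun i j => hG.near_one t ht y i j)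
      (fun a' c' => hR.abs_inverse_entry_le_two hG hθ ht y a' c') a m)
    (fun y a m c => hR.abs_partialDeriv_inv_le ht y a m c)
  have e1 : (1 - 3 * (6 * θ)) ^ 2 / 2 = (1 - 18 * θ) ^ 2 / 2 := by ring
  have e2 : 27 * (2 * θ * nC) ^ 2 = 108 * θ ^ 2 * nC ^ 2 := by ring
  rw [e1, e2] at key
  exact key

end Summit.AnomalousDissipation.AnomalousDissipation.Theorems.SolenoidalFractalHomogenisation.LagrangianStep.VmodDist

end
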